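import Literature.LinearAlgebra.Alternating.WedgeOne
import Mathlib.Analysis.Complex.Basic
import HarnessLib

/-!
# Contraction with `∂/∂z̄_v` and the anticommutation relations with `θ ∧ ·`

On complex-valued (more generally `F`-valued, `F` a complex normed space) *real*-multilinear
alternating forms `η : E [⋀^Fin (n+1)]→L[ℝ] F` on a complex normed space `E` we define the
**contraction with the complexified vector `∂/∂z̄_v = ½ (v ⊗ 1 + (iv) ⊗ i)`**,

  `dbarContract v η = ½ (v ⌟ η + i • (iv) ⌟ η)`,   `(w ⌟ η)(…) = η(w, …)`,

(`Literature.Analysis.Complex.dbarContract`; for `E = ℂⁿ`, `v = e_j` this extracts the coefficient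
of `dz̄_j`: it kills `dz_l ∧ ·` and pairs with `dz̄_l ∧ ·` to `δ_{jl}`, Hörmander (1973), §2.1),
and prove its anticommutation relations with the wedge `θ ∧ ·` by a constant `1`-form
(`Literature.LinearAlgebra.Alternating.wedgeOne`):

* `dbarContract_wedgeOne_of_conj`: for `θ` conjugate-linear (`θ(iw) = -i θ(w)`, e.g. `θ = dz̄_l`),
  `∂/∂z̄_v ⌟ (θ ∧ η) + θ ∧ (∂/∂z̄_v ⌟ η) = θ(v) η`;
* `dbarContract_wedgeOne_of_linear`: for `θ` complex-linear (e.g. `θ = dz_l`),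
  `∂/∂z̄_v ⌟ (θ ∧ η) = -θ ∧ (∂/∂z̄_v ⌟ η)`;
* `dbarContract_dbarContract_swap`: `∂/∂z̄_v ⌟ ∂/∂z̄_w ⌟ η = -∂/∂z̄_w ⌟ ∂/∂z̄_v ⌟ η`.

These are the relations of a `Literature.Analysis.Complex.DbarFrame` (creation `dz̄_j ∧ ·`,
annihilation `∂/∂z̄_j ⌟ ·`) before restriction to `(p,q)`-types.

## References

* L. Hörmander, *An Introduction to Complex Analysis in Several Variables*, 2nd ed. (1973),
  §2.1. [HormanderSCV1973]
* F. W. Warner, *Foundations of Differentiable Manifolds and Lie Groups* (1983), 2.11.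
  [Warner1983]
-/

noncomputable section

open ContinuousAlternatingMap Function Complex
open Literature.LinearAlgebra.Alternating

namespace Literature.Analysis.Complex

variable {E : Type*} [NormedAddCommGroup E] [NormedSpace ℂ E]
  {F : Type*} [NormedAddCommGroup F] [NormedSpace ℂ F] {n : ℕ}

/-- **Contraction with `∂/∂z̄_v`**: `∂/∂z̄_v ⌟ η = ½ (v ⌟ η + i • (iv) ⌟ η)` on real-multilinear
`F`-valued alternating forms (`F` complex), as a `ℂ`-linear continuous operator lowering the
degree by one (Hörmander (1973), §2.1: the coefficient of `dz̄_j` for `v = e_j`).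
[cite: HormanderSCV1973, §2.1] -/
def dbarContract (v : E) : (E [⋀^Fin (n + 1)]→L[ℝ] F) →L[ℂ] (E [⋀^Fin n]→L[ℝ] F) :=
  (2 : ℂ)⁻¹ • (curryLeftL v + I • curryLeftL (I • v))

/-- Unfolding of `dbarContract` as forms. [folklore] -/
theorem dbarContract_eq (v : E) (η : E [⋀^Fin (n + 1)]→L[ℝ] F) :
    dbarContract v η = (2 : ℂ)⁻¹ • (η.curryLeft v + I • η.curryLeft (I • v)) := by
  simp [dbarContract]

/-- Unfolding of `dbarContract` on vectors: `(∂/∂z̄_v ⌟ η)(w) = ½ (η(v, w) + i η(iv, w))`.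
[folklore] -/
theorem dbarContract_apply (v : E) (η : E [⋀^Fin (n + 1)]→L[ℝ] F) (w : Fin n → E) :
    dbarContract v η w =
      (2 : ℂ)⁻¹ • (η (Matrix.vecCons v w) + I • η (Matrix.vecCons (I • v) w)) := by
  simp [dbarContract_eq]

/-! ### Anticommutation with the wedge by a `1`-form -/

/-- For a **conjugate-linear** `1`-form `θ` (`θ(iw) = -i θ(w)`, e.g. `dz̄_l`) and a form `η` of
positive degree: `∂/∂z̄_v ⌟ (θ ∧ η) + θ ∧ (∂/∂z̄_v ⌟ η) = θ(v) • η` (Hörmander (1973), §2.1: the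
coefficient calculus `f = dz̄_k ∧ g + h`; Warner (1983), 2.11). [cite: HormanderSCV1973, §2.1] -/
theorem dbarContract_wedgeOne_of_conj {θ : E →L[ℝ] ℂ} (hθ : ∀ w, θ (I • w) = -I * θ w) (v : E)
    (η : E [⋀^Fin (n + 1)]→L[ℝ] F) :
    dbarContract v (wedgeOne θ η) + wedgeOne θ (dbarContract v η) = θ v • η := by
  rw [dbarContract_eq, dbarContract_eq, curryLeft_wedgeOne, curryLeft_wedgeOne, hθ,
    wedgeOne_smul, wedgeOne_add, wedgeOne_smul]
  match_scalars <;> first | ring1 | linear_combination (-(2 : ℂ)⁻¹ * θ v) * I_mul_I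

/-- Degree-`0` companion: for a conjugate-linear `θ` and a `0`-form `η`,
`∂/∂z̄_v ⌟ (θ ∧ η) = θ(v) • η`. [cite: HormanderSCV1973, §2.1] -/
theorem dbarContract_wedgeOne_of_conj_zero {θ : E →L[ℝ] ℂ} (hθ : ∀ w, θ (I • w) = -I * θ w)
    (v : E) (η : E [⋀^Fin 0]→L[ℝ] F) :
    dbarContract v (wedgeOne θ η) = θ v • η := by
  rw [dbarContract_eq, curryLeft_wedgeOne_zero, curryLeft_wedgeOne_zero, hθ, smul_smul, ← add_smul,
    smul_smul]
  congr 1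
  linear_combination (-(2 : ℂ)⁻¹ * θ v) * I_mul_I

/-- For a **complex-linear** `1`-form `θ` (e.g. `dz_l`) and `η` of positive degree:
`∂/∂z̄_v ⌟ (θ ∧ η) = -θ ∧ (∂/∂z̄_v ⌟ η)` (`∂/∂z̄_v` does not see `dz_l`). [cite: HormanderSCV1973, §2.1] -/
theorem dbarContract_wedgeOne_of_linear {θ : E →L[ℝ] ℂ} (hθ : ∀ w, θ (I • w) = I * θ w) (v : E)
    (η : E [⋀^Fin (n + 1)]→L[ℝ] F) :
    dbarContract v (wedgeOne θ η) = -wedgeOne θ (dbarContract v η) := by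
  rw [dbarContract_eq, dbarContract_eq, curryLeft_wedgeOne, curryLeft_wedgeOne, hθ,
    wedgeOne_smul, wedgeOne_add, wedgeOne_smul]
  match_scalars <;> first | ring1 | linear_combination ((2 : ℂ)⁻¹ * θ v) * I_mul_I

/-- Degree-`0` companion: for a complex-linear `θ` and a `0`-form `η`, `∂/∂z̄_v ⌟ (θ ∧ η) = 0`.
[cite: HormanderSCV1973, §2.1] -/
theorem dbarContract_wedgeOne_of_linear_zero {θ : E →L[ℝ] ℂ} (hθ : ∀ w, θ (I • w) = I * θ w)
    (v : E) (η : E [⋀^Fin 0]→L[ℝ] F) :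
    dbarContract v (wedgeOne θ η) = 0 := by
  rw [dbarContract_eq, curryLeft_wedgeOne_zero, curryLeft_wedgeOne_zero, hθ, smul_smul, ← add_smul,
    smul_smul, show (2 : ℂ)⁻¹ * (θ v + I * (I * θ v)) = 0 by
      linear_combination ((2 : ℂ)⁻¹ * θ v) * I_mul_I, zero_smul]

/-! ### Anticommutation of contractions -/

/-- **Contractions anticommute**: `∂/∂z̄_v ⌟ (∂/∂z̄_w ⌟ η) = -∂/∂z̄_w ⌟ (∂/∂z̄_v ⌟ η)`.
[cite: HormanderSCV1973, §2.1] -/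
theorem dbarContract_dbarContract_swap (v w : E) (η : E [⋀^Fin (n + 2)]→L[ℝ] F) :
    dbarContract v (dbarContract w η) = -dbarContract w (dbarContract v η) := by
  have hswap : ∀ a b : E, ∀ u : Fin n → E,
      η (Matrix.vecCons a (Matrix.vecCons b u)) = -η (Matrix.vecCons b (Matrix.vecCons a u)) :=
    fun a b u => by
      rw [vecCons_vecCons_eq_comp_swap a b u]
      exact η.toAlternatingMap.map_swap _ (by simp)
  ext u
  simp only [dbarContract_apply, ContinuousAlternatingMap.neg_apply, smul_add, smul_smul]
  rw [hswap w v, hswap (I • w) v, hswap w (I • v), hswap (I • w) (I • v)]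
  module

/-- `∂/∂z̄_v ⌟ (∂/∂z̄_v ⌟ η) = 0`. [cite: HormanderSCV1973, §2.1] -/
theorem dbarContract_dbarContract_self (v : E) (η : E [⋀^Fin (n + 2)]→L[ℝ] F) :
    dbarContract v (dbarContract v η) = 0 := by
  have h := dbarContract_dbarContract_swap v v η
  have h2 : (2 : ℂ) • dbarContract v (dbarContract v η) = 0 := by
    rw [two_smul]; nth_rw 1 [h]; exact neg_add_cancel _
  exact (smul_eq_zero.mp h2).resolve_left two_ne_zero

/-! ### The coordinate `1`-forms `dz_j`, `dz̄_j` on `ℂ^ι` -/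

section Coordinates

variable {ι : Type*} [Fintype ι] [DecidableEq ι]

/-- The coordinate `1`-form `dz_j : v ↦ v_j` on `ℂ^ι`, as a real-linear complex-valued
functional. [cite: HormanderSCV1973, §2.1] -/
def dz (j : ι) : (ι → ℂ) →L[ℝ] ℂ :=
  (ContinuousLinearMap.proj (R := ℂ) j).restrictScalars ℝ

/-- The coordinate `1`-form `dz̄_j : v ↦ conj v_j` on `ℂ^ι`. [cite: HormanderSCV1973, §2.1] -/
def dzBar (j : ι) : (ι → ℂ) →L[ℝ] ℂ :=
  conjCLE.toContinuousLinearMap ∘L dz j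

omit [Fintype ι] [DecidableEq ι] in
/-- `dz_j v = v_j`. [folklore] -/
@[simp]
theorem dz_apply (j : ι) (v : ι → ℂ) : dz j v = v j := rfl

omit [Fintype ι] [DecidableEq ι] in
/-- `dz̄_j v = conj v_j`. [folklore] -/
@[simp]
theorem dzBar_apply (j : ι) (v : ι → ℂ) : dzBar j v = starRingEnd ℂ (v j) := rfl

omit [Fintype ι] [DecidableEq ι] in
/-- `dz_j` is complex-linear. [folklore] -/
theorem dz_I_smul (j : ι) (w : ι → ℂ) : dz j (I • w) = I * dz j w := by
  simp

omit [Fintype ι] [DecidableEq ι] in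
/-- `dz̄_j` is conjugate-linear. [folklore] -/
theorem dzBar_I_smul (j : ι) (w : ι → ℂ) : dzBar j (I • w) = -I * dzBar j w := by
  simp [conj_I]

omit [Fintype ι] in
/-- `dz̄_l (e_j) = δ_{jl}`. [folklore] -/
theorem dzBar_single (l j : ι) : dzBar l (Pi.single j (1 : ℂ)) = if j = l then 1 else 0 := by
  by_cases h : j = l
  · subst h; simp
  · simp [h]

/-- **The coefficient calculus of `dz̄`**: `∂/∂z̄_j ⌟ (dz̄_l ∧ η) + dz̄_l ∧ (∂/∂z̄_j ⌟ η) = δ_{jl} η`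
(Hörmander (1973), §2.1). [cite: HormanderSCV1973, §2.1] -/
theorem dbarContract_single_wedgeOne_dzBar (j l : ι) (η : (ι → ℂ) [⋀^Fin (n + 1)]→L[ℝ] F) :
    dbarContract (Pi.single j 1) (wedgeOne (dzBar l) η) +
      wedgeOne (dzBar l) (dbarContract (Pi.single j 1) η) = if j = l then η else 0 := by
  rw [dbarContract_wedgeOne_of_conj (dzBar_I_smul l), dzBar_single]
  split_ifs <;> simp

/-- Degree `0`: `∂/∂z̄_j ⌟ (dz̄_l ∧ η) = δ_{jl} η` for a `0`-form `η`. [cite: HormanderSCV1973, §2.1] -/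
theorem dbarContract_single_wedgeOne_dzBar_zero (j l : ι) (η : (ι → ℂ) [⋀^Fin 0]→L[ℝ] F) :
    dbarContract (Pi.single j 1) (wedgeOne (dzBar l) η) = if j = l then η else 0 := by
  rw [dbarContract_wedgeOne_of_conj_zero (dzBar_I_smul l), dzBar_single]
  split_ifs <;> simp

end Coordinates

end Literature.Analysis.Complex
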